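import Summits.CriticalPhenomena.PercolationContinuityZ3.Theorems.Transplant.FKConnectivityAllQArborealClusterDomCex
import Summits.CriticalPhenomena.PercolationContinuityZ3.Theorems.Transplant.FKConnectivityAllQTwoClusterFibres
import HarnessLib

/-!
# A fast kernel evaluator for fibre counts on listed graphs: bitmask BFS closures, component count, forests, reachability
# (proved equal to the tree's `openGraph` / `clusterCount` / `IsForestCfg` / `fibreCount`), with a binary-split counting loop

Support file (`--supports stmt-CriticalPhenomena-4575`), FK sub-lane `prim-bschramm-fk-1` (gen 17) of the post-continuity programme;
builds on p205010 (kernel theorem, internal audit signed; external expert review pending).  Definitions (computable evaluators on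
fk-3 g5's listed-graph data `FK.RCEval`), no named facts, no sorries; standard axioms.  No `decide` is run in this file.

WHY.  The lineage's conjecture nodes are COUNTING statements over fibres of configurations (`fibreCount M u A B`, fk-1 g13), and
their refutations so far used closed forms on special families.  A sporadic counterexample (fk-1 g16's 9-vertex, 13-edge graph
against the CHLW square, memo bschramm/FROM-fk-1-g16-FOREST-SLICE.md §1c) needs the kernel to evaluate `2¹³` configurations; the
existing bridge `RCEval.reachB` (open walks by depth-`n` search without a visited set) and `Finset.powerset` enumeration do not
scale to that (measured: kernel deep recursion at `2¹³`-element lists; exponential walk search on 10 vertices).  This file gives a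
bridge whose kernel cost is a few thousand reduction steps per configuration (measured 5.5 ms per configuration on the farm):
* vertex sets and configurations are bitmasks (`ℕ`, raw `Nat.land / Nat.lor / Nat.beq`, GMP-accelerated in the kernel);
* `expand es S` = one breadth-first round over the endpoint masks `es` of the open pairs; `closure es f S` = `f` rounds with early
  exit at a fixpoint (`closure_eq_iterate`); **`testBit_closure_iff`**: the closure of `{u}` with fuel `n` is EXACTLY the open cluster
  of `u` (soundness by induction on rounds, completeness along a shortest path of length `< n`);
* `comps` scans the vertices in increasing order and records the closure of every vertex not yet covered — **`length_compsOf`**: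
  their number is the number of vertices least in their cluster, i.e. `clusterCount` (`kOf_eq_clusterCount`, via fk-3 g5's
  `natCard_connectedComponent_eq_card_filter`), and **`joinedB_iff`**: two vertices are joined iff some recorded closure holds both;
* `forestB_iff`: forest `⟺ k + |ω| = n` (census g20's `isForestCfg_conf_iff`);
* **`fibreCount_conf_eq_card`**: on the fibre `(M, ∅)` with `M` = the first `d` listed pairs, `fibreCount M ∅ A B` is the number of
  masks `a < 2^d` with `conf (tOf a) ∈ A` and `conf (tOf ((2^d − 1) xor a)) ∈ B` (bijection mask ↔ sub-configuration through
  `Finset.equivBitIndices`); `card_filter_range_eq_sumR` turns such a count into the binary-split loop `sumR` (recursion depth `d`,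
  no long lists), which `decide +kernel` evaluates.
FILES.  This file: the computable definitions, the bit lemmas, the specification of one breadth-first round (`testBit_expand`) and of
the early-exit closure (`closure_eq_iterate`), and the reading of masks as listed sub-configurations (`mem_openEM`, `adj_conf_tOf_iff`).
`…FastEvalClusters.lean`: closure = cluster, `comps` / `kOf` / `joinedB` / `forestB` specifications.  `…FastEvalBridge.lean`: the mask
bridge for `fibreCount` and the `sumR` lemmas.  First user: `…ForestSquareCex.lean` (kernel refutation of `TwoClusterRayleighGradedPos`).
[cite: Grimmett2006, §1.2 eq. (1.1) (p. 4); §1.5 (p. 13)] [cite: Linusson2011, Prop. 2.6]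
-/

namespace Summit.CriticalPhenomena.PercolationContinuityZ3.Theorems

namespace FK

namespace RCEval

open Literature.Probability.LatticeModels Literature.Probability.Percolation
open scoped Classical

variable (D : RCEval)

/-! ### The computable evaluator (raw `Nat` bit operations) -/

/-- The listed pairs as `(2^i, 2^{src i} ||| 2^{dst i})` (index bit, endpoint mask). [folklore] -/
def pm : List (ℕ × ℕ) :=
  (List.finRange D.m).map fun i => (2 ^ i.val, Nat.lor (2 ^ (D.src i).val) (2 ^ (D.dst i).val))

/-- Endpoint masks of the pairs open in the configuration mask `a`. [folklore] -/
def openEM (a : ℕ) : List ℕ :=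
  D.pm.filterMap fun p => cond (Nat.beq (Nat.land a p.1) 0) none (some p.2)

/-- One breadth-first round: add both endpoints of every open pair meeting the vertex mask `S`. [folklore] -/
def expand (es : List ℕ) (S : ℕ) : ℕ :=
  es.foldl (fun acc em => cond (Nat.beq (Nat.land S em) 0) acc (Nat.lor acc em)) S

/-- Breadth-first closure with fuel, stopping early at a fixpoint. [folklore] -/
def closure (es : List ℕ) : ℕ → ℕ → ℕ
  | 0, S => S
  | f + 1, S => cond (Nat.beq (expand es S) S) S (closure es f (expand es S))

/-- Scan the vertices `n - k, …, n - 1` in increasing order; for each vertex not yet covered by `vis`, record the closure of that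
vertex and add it to `vis`.  Returns the recorded closures (the open clusters, each once). [cite: Grimmett2006, §1.2 eq. (1.1) (p. 4)] -/
def comps (es : List ℕ) : ℕ → ℕ → List ℕ → List ℕ
  | 0, _, acc => acc
  | k + 1, vis, acc =>
    cond (Nat.beq (Nat.land vis (2 ^ (D.n - (k + 1)))) 0)
      (comps es k (Nat.lor vis (closure es D.n (2 ^ (D.n - (k + 1))))) (closure es D.n (2 ^ (D.n - (k + 1))) :: acc))
      (comps es k vis acc)

/-- The open clusters of the configuration mask `a`, as vertex masks. [cite: Grimmett2006, §1.2 eq. (1.1) (p. 4)] -/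
def compsOf (a : ℕ) : List ℕ := D.comps (D.openEM a) D.n 0 []

/-- **The number of open clusters** of the configuration mask `a` (computable). [cite: Grimmett2006, §1.2 eq. (1.1) (p. 4)] -/
def kOf (a : ℕ) : ℕ := (D.compsOf a).length

/-- The set of listed-pair indices open in the mask `a`. [folklore] -/
def tOf (a : ℕ) : Finset (Fin D.m) := Finset.univ.filter fun i => a.testBit i.val = true

/-- The number of open listed pairs of the mask `a` (computable). [folklore] -/
def popc (a : ℕ) : ℕ := (D.openEM a).length

/-- **Forest test** `k + |ω| = n` (computable). [cite: Grimmett2006, §1.5 (p. 13)] -/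
def forestB (a : ℕ) : Bool := Nat.beq (D.kOf a + D.popc a) D.n

/-- **Join test**: some recorded cluster contains both `u` and `v` (computable). [cite: Grimmett2006, §1.2 eq. (1.1) (p. 4)] -/
def joinedB (Cs : List ℕ) (u v : ℕ) : Bool :=
  Cs.any fun C => !(Nat.beq (Nat.land C (2 ^ u)) 0) && !(Nat.beq (Nat.land C (2 ^ v)) 0)

/-- **Binary-split sum** `Σ_{a ∈ [b, b + 2^d)} F a` (recursion depth `d`; kernel-friendly). [folklore] -/
def sumR (F : ℕ → ℕ) : ℕ → ℕ → ℕ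
  | 0, b => F b
  | d + 1, b => sumR F d b + sumR F d (b + 2 ^ d)

/-- The first `d` listed pairs. [folklore] -/
def firstT (d : ℕ) : Finset (Fin D.m) := Finset.univ.filter fun i => i.val < d

/-- The mask of a set of listed-pair indices. [folklore] -/
def maskOf (t : Finset (Fin D.m)) : ℕ := ∑ i ∈ t, 2 ^ i.val

variable {D}

/-! ### Bit lemmas -/

/-- `x &&& y ≠ 0` iff the two masks share a bit. [folklore] -/
theorem land_ne_zero_iff (x y : ℕ) : Nat.land x y ≠ 0 ↔ ∃ j, x.testBit j = true ∧ y.testBit j = true := by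
  rw [Nat.land_eq]
  constructor
  · intro h
    obtain ⟨j, hj⟩ := Nat.exists_testBit_of_ne_zero h
    rw [Nat.testBit_and, Bool.and_eq_true] at hj
    exact ⟨j, hj⟩
  · rintro ⟨j, hx, hy⟩ h
    have := congrArg (fun z => Nat.testBit z j) h
    simp only [Nat.testBit_and, hx, hy, Bool.and_self, Nat.zero_testBit] at this
    exact Bool.noConfusion this

/-- `beq (x &&& y) 0 = false` iff the masks share a bit. [folklore] -/
theorem beq_land_eq_false_iff (x y : ℕ) : Nat.beq (Nat.land x y) 0 = false ↔ ∃ j, x.testBit j = true ∧ y.testBit j = true := by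
  rw [← land_ne_zero_iff]
  cases h : Nat.beq (Nat.land x y) 0
  · exact ⟨fun _ => Nat.ne_of_beq_eq_false h, fun _ => rfl⟩
  · exact ⟨fun h' => Bool.noConfusion h', fun h' => absurd (Nat.eq_of_beq_eq_true h) h'⟩

/-- `beq (x &&& y) 0 = true` iff the masks share no bit. [folklore] -/
theorem beq_land_eq_true_iff (x y : ℕ) : Nat.beq (Nat.land x y) 0 = true ↔ ¬ ∃ j, x.testBit j = true ∧ y.testBit j = true := by
  rw [← beq_land_eq_false_iff, Bool.not_eq_false]

/-- `x &&& 2^u ≠ 0` iff bit `u` of `x` is set. [folklore] -/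
theorem land_two_pow_ne_zero_iff (x u : ℕ) : Nat.land x (2 ^ u) ≠ 0 ↔ x.testBit u = true := by
  rw [land_ne_zero_iff]
  constructor
  · rintro ⟨j, hx, hj⟩
    rw [Nat.testBit_two_pow] at hj
    have := of_decide_eq_true hj
    subst this; exact hx
  · intro h; exact ⟨u, h, by rw [Nat.testBit_two_pow]; exact decide_eq_true rfl⟩

/-- `!(beq (x &&& 2^u) 0) = true` iff bit `u` of `x` is set. [folklore] -/
theorem not_beq_land_two_pow_iff (x u : ℕ) : (!(Nat.beq (Nat.land x (2 ^ u)) 0)) = true ↔ x.testBit u = true := by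
  rw [← land_two_pow_ne_zero_iff]
  cases h : Nat.beq (Nat.land x (2 ^ u)) 0
  · exact ⟨fun _ => Nat.ne_of_beq_eq_false h, fun _ => rfl⟩
  · exact ⟨fun h' => Bool.noConfusion h', fun h' => absurd (Nat.eq_of_beq_eq_true h) h'⟩

/-- Bits of an endpoint mask. [folklore] -/
theorem testBit_lor_two_pow (p q x : ℕ) : (Nat.lor (2 ^ p) (2 ^ q)).testBit x = true ↔ x = p ∨ x = q := by
  rw [Nat.lor_eq, Nat.testBit_or, Bool.or_eq_true, Nat.testBit_two_pow, Nat.testBit_two_pow, decide_eq_true_iff,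
    decide_eq_true_iff]
  constructor
  · rintro (h | h) <;> [exact Or.inl h.symm; exact Or.inr h.symm]
  · rintro (h | h) <;> [exact Or.inl h.symm; exact Or.inr h.symm]

/-! ### `expand` and `closure` -/

/-- Bits of one breadth-first round. [folklore] -/
theorem testBit_expand (es : List ℕ) (S : ℕ) (x : ℕ) :
    (expand es S).testBit x = true ↔
      S.testBit x = true ∨ ∃ em ∈ es, (∃ j, S.testBit j = true ∧ em.testBit j = true) ∧ em.testBit x = true := by
  unfold expand
  suffices h : ∀ acc : ℕ, (es.foldl (fun acc em => cond (Nat.beq (Nat.land S em) 0) acc (Nat.lor acc em)) acc).testBit x = true ↔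
      acc.testBit x = true ∨ ∃ em ∈ es, (∃ j, S.testBit j = true ∧ em.testBit j = true) ∧ em.testBit x = true from h S
  induction es with
  | nil => intro acc; simp
  | cons em es ih =>
    intro acc
    rw [List.foldl_cons, ih]
    have hstep : (cond (Nat.beq (Nat.land S em) 0) acc (Nat.lor acc em)).testBit x = true ↔
        acc.testBit x = true ∨ ((∃ j, S.testBit j = true ∧ em.testBit j = true) ∧ em.testBit x = true) := by
      cases hb : Nat.beq (Nat.land S em) 0
      · have hm := (beq_land_eq_false_iff S em).1 hb
        simp only [cond_false, Nat.lor_eq, Nat.testBit_or, Bool.or_eq_true]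
        exact ⟨fun h => h.elim Or.inl fun h' => Or.inr ⟨hm, h'⟩, fun h => h.elim Or.inl fun h' => Or.inr h'.2⟩
      · have hm := (beq_land_eq_true_iff S em).1 hb
        simp only [cond_true]
        exact ⟨Or.inl, fun h => h.elim id fun h' => absurd h'.1 hm⟩
    rw [hstep]
    constructor
    · rintro ((h | h) | ⟨em', hem', h⟩)
      · exact Or.inl h
      · exact Or.inr ⟨em, List.mem_cons_self, h⟩
      · exact Or.inr ⟨em', List.mem_cons_of_mem _ hem', h⟩
    · rintro (h | ⟨em', hem', h⟩)
      · exact Or.inl (Or.inl h)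
      · rcases List.mem_cons.1 hem' with rfl | hem'
        · exact Or.inl (Or.inr h)
        · exact Or.inr ⟨em', hem', h⟩

/-- `expand` only adds bits. [folklore] -/
theorem testBit_expand_of_testBit (es : List ℕ) {S x : ℕ} (h : S.testBit x = true) : (expand es S).testBit x = true :=
  (testBit_expand es S x).2 (Or.inl h)

/-- The early-exit closure equals plain iteration of `expand`. [folklore] -/
theorem closure_eq_iterate (es : List ℕ) (f S : ℕ) : closure es f S = (expand es)^[f] S := by
  induction f generalizing S with
  | zero => rfl
  | succ f ih =>
    show cond (Nat.beq (expand es S) S) S (closure es f (expand es S)) = _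
    cases hb : Nat.beq (expand es S) S
    · rw [cond_false, ih, ← Function.iterate_succ_apply]
    · rw [cond_true]
      have hfix : expand es S = S := Nat.eq_of_beq_eq_true hb
      exact (Function.iterate_fixed hfix _).symm

/-- Iterates of `expand` only add bits. [folklore] -/
theorem testBit_iterate_mono (es : List ℕ) (S x : ℕ) {i j : ℕ} (hij : i ≤ j) (h : ((expand es)^[i] S).testBit x = true) :
    ((expand es)^[j] S).testBit x = true := by
  induction j with
  | zero =>
    have : i = 0 := Nat.le_zero.1 hij
    subst this; exact h
  | succ j ih =>
    rcases Nat.lt_or_eq_of_le hij with hlt | rfl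
    · rw [Function.iterate_succ_apply']
      exact testBit_expand_of_testBit es (ih (Nat.lt_succ_iff.1 hlt))
    · exact h

/-! ### The listed graph of a mask -/

/-- Membership in `tOf`. [folklore] -/
@[simp] theorem mem_tOf (a : ℕ) (i : Fin D.m) : i ∈ D.tOf a ↔ a.testBit i.val = true := by
  unfold tOf; rw [Finset.mem_filter]; exact ⟨fun h => h.2, fun h => ⟨Finset.mem_univ _, h⟩⟩

/-- The endpoint masks of the open pairs. [folklore] -/
theorem mem_openEM (a em : ℕ) :
    em ∈ D.openEM a ↔ ∃ i : Fin D.m, a.testBit i.val = true ∧ em = Nat.lor (2 ^ (D.src i).val) (2 ^ (D.dst i).val) := by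
  unfold openEM pm
  rw [List.mem_filterMap]
  constructor
  · rintro ⟨p, hp, h⟩
    obtain ⟨i, -, rfl⟩ := List.mem_map.1 hp
    cases hb : Nat.beq (Nat.land a (2 ^ i.val)) 0
    · rw [hb, cond_false, Option.some.injEq] at h
      exact ⟨i, (land_two_pow_ne_zero_iff a i.val).1 (Nat.ne_of_beq_eq_false hb), h.symm⟩
    · rw [hb, cond_true] at h
      exact absurd h (by simp)
  · rintro ⟨i, hi, rfl⟩
    refine ⟨(2 ^ i.val, Nat.lor (2 ^ (D.src i).val) (2 ^ (D.dst i).val)), List.mem_map.2 ⟨i, List.mem_finRange i, rfl⟩, ?_⟩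
    have hb : Nat.beq (Nat.land a (2 ^ i.val)) 0 = false := by
      cases h : Nat.beq (Nat.land a (2 ^ i.val)) 0
      · rfl
      · exact absurd (Nat.eq_of_beq_eq_true h) ((land_two_pow_ne_zero_iff a i.val).2 hi)
    simp only [hb, cond_false]

/-- Membership of a pair in the configuration of a mask. [folklore] -/
theorem mem_conf_tOf_iff (a : ℕ) (g : Sym2 (Fin D.n)) :
    g ∈ D.conf (D.tOf a) ↔ ∃ i : Fin D.m, a.testBit i.val = true ∧ D.edge i = g := by
  unfold conf
  rw [Finset.mem_coe, Finset.mem_image]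
  simp only [mem_tOf]

/-- Adjacency in the open graph of a mask. [folklore] -/
theorem adj_conf_tOf_iff (a : ℕ) (u w : Fin D.n) :
    (openGraph (D.conf (D.tOf a))).Adj u w ↔ (∃ i : Fin D.m, a.testBit i.val = true ∧ D.edge i = s(u, w)) ∧ u ≠ w := by
  rw [openGraph_adj, mem_conf_tOf_iff]

end RCEval

end FK

end Summit.CriticalPhenomena.PercolationContinuityZ3.Theorems
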